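import Literature.Computability.QuantumComplexity.JuxtaposedDeciders
import Literature.Computability.QuantumComplexity.PromiseBQPGateSetIndependence
import HarnessLib

/-!
# Crux `ArithStatLadder.IqThreeMemBQP` (stmt-QuantumAdvantage-2424), line `scholz-mirror-siegel` — stub `stub_guardedOr`

Registered stub of the line skeleton `Cruxes/IqThreeMemBQP/Lines/scholz_mirror_siegel.lean` (reshape r3:
the signature below is stated over tree constants only and must stay BYTE-IDENTICAL to the registered
one — edit only the proof and add helper lemmas above it).

Proof summary (generic closure of `BQP` / `PromiseBQP`, no arithmetic). The four problems
`G` (as the trivial-promise problem `PromiseProblem.ofLanguage G`), `Q₁`, `Q₂`, `Q₃` are decided with error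
`≤ 1/24` on their promises by uniform oracle-free Clifford+`T` families
(`PromiseBQPWith_eq_PromiseBQP`, `Literature/Computability/QuantumComplexity/PromiseBQPGateSetIndependence.lean`).
The four families are run side by side on copies of the input inside ONE polynomial-time generated
circuit (`Juxt.circ`, `Literature/Computability/QuantumComplexity/JuxtaposedDeciders.lean`): the tuple of
answer wires follows the product of the four answer laws (`Juxt.probEvent_circ`), the generator is
polynomial time (`Juxt.codeFP_gen`), and the universal executor with classical post-processing
(`isQSolvable_of_generated_circuits`, `mem_BQP_of_isQSolvable_bit`) is packaged as
`Juxt.mem_BQP_of_truthTable`: it suffices that the truth table — the hard-wired answer on `E`, the guarded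
OR `g ∧ (q₁ ∨ q₂ ∨ q₃)` elsewhere, computed on codes (`guardedOr_codeFP_table`) — agrees with membership
in `L` on a set of answer patterns of product mass `≥ 2/3`. The budget uses the promised sides only
(`guardedOr_cylinder` = `Juxt.prod_le_sum_of_cylinder`): on `E` every pattern is good; a member outside
`E` lies in `G` and some `Qᵢ.yes`, so the cylinder `{g = 1, qᵢ = 1}` has mass `≥ (23/24)²`; a non-member
outside `E` lies outside `G` (cylinder `{g = 0}`, mass `≥ 23/24`) or in all three `Qᵢ.no` (cylinder
`{q₁ = q₂ = q₃ = 0}`, mass `≥ (23/24)³ ≥ 2/3`).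
-/

namespace Summit.QuantumAdvantage.QuantumAdvantage.Theorems.ArithStatLadder.IqThreeMemBQP

open _root_.Computability Literature.Computability.Complexity Literature.Computability.Cryptography
open Literature.Computability.QuantumComplexity Literature.Computability.Complexity.CodeFP

/-! ## Helper lemmas -/

/-- A `PromiseBQP` problem is decided with error `≤ 1/24` on its promise by a uniform oracle-free
Clifford+`T` family (`PromiseBQPWith_eq_PromiseBQP`, majority amplification).
[cite: Watrous2009, §III.2 and Prop. 3] -/
theorem guardedOr_exists_family {Q : PromiseProblem} (hQ : Q ∈ PromiseBQP) :
    ∃ F : QCircuitFamily cliffordT, F.IsOracleFree ∧ F.IsUniform ∧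
      (∀ x ∈ Q.yes, 1 - 1 / 24 ≤ F.acceptProbOn 0 x) ∧ (∀ x ∈ Q.no, F.acceptProbOn 0 x ≤ 1 / 24) := by
  rw [← PromiseBQPWith_eq_PromiseBQP (ε := 1 / 24) (by norm_num) (by norm_num)] at hQ
  exact hQ

/-- **The truth table of the decider is computed on codes** through the answer bits of the juxtaposed
families: the hard-wired answer on the exception list `Es` (membership in the list `Ts` of its members),
the guarded OR `γ₀ ∧ (γ₁ ∨ γ₂ ∨ γ₃)` elsewhere. [cite: BernsteinVazirani1997, §8 (classical post-processing)] -/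
theorem guardedOr_codeFP_table (fam : Fin 4 → QCircuitFamily cliffordT) (hU : ∀ j, (fam j).IsUniform)
    (Es Ts : List (List Bool)) :
    CodeFP (pairE strE strE) strE fun p => [if decide (p.1 ∈ Es) then decide (p.1 ∈ Ts) else
      (Juxt.ansBits fam p.1 p.2 0 && (Juxt.ansBits fam p.1 p.2 1 || Juxt.ansBits fam p.1 p.2 2 ||
        Juxt.ansBits fam p.1 p.2 3))] := by
  have hx : CodeFP (pairE strE strE) strE Prod.fst := fst _ _
  have hinj : Function.Injective strE := fun _ _ h => h
  have hE : CodeFP (pairE strE strE) bitE (fun p => decide (p.1 ∈ Es)) := (mem hinj).comp (hx.pair (const _ Es))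
  have hT : CodeFP (pairE strE strE) bitE (fun p => decide (p.1 ∈ Ts)) := (mem hinj).comp (hx.pair (const _ Ts))
  have hb := fun j => Juxt.codeFP_ansBit fam hU j
  exact (hE.ite hT ((hb 0).and (((hb 1).or (hb 2)).or (hb 3)))).recodeOut (eγ := strE) fun _ => rfl

/-- **A cylinder of the product measure with mass `≥ 2/3` forces the decision.** [folklore] -/
theorem guardedOr_cylinder (w : Fin 4 → Bool → ℝ) (hw0 : ∀ j c, 0 ≤ w j c) (hw1 : ∀ j, w j true + w j false = 1)
    (S : Finset (Fin 4)) (π : Fin 4 → Bool) (Φx : (Fin 4 → Bool) → Bool) (b : Bool)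
    (hP : ∀ γ, (∀ j ∈ S, γ j = π j) → Φx γ = b) (hS : 2 / 3 ≤ ∏ j ∈ S, w j (π j)) :
    2 / 3 ≤ ∑ γ, if Φx γ = b then ∏ j, w j (γ j) else 0 :=
  hS.trans (Juxt.prod_le_sum_of_cylinder w hw0 hw1 S π (fun γ => Φx γ = b) hP)

/-! ## The registered stub (signature verbatim) -/

/-- **S7 `stub_guardedOr`** (GENERIC closure property of `BQP`/`PromiseBQP`; no arithmetic). If
`G ∈ BQP`, `Q₁, Q₂, Q₃ ∈ PromiseBQP`, and outside a finite exception set `E` every member of `L` lies in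
`G` and in some `Qᵢ.yes` while every non-member lies outside `G` or in all three `Qᵢ.no`, then
`L ∈ BQP`. Proof: amplify the four problems (`G` as the trivial-promise problem) to error `≤ 1/24` on
their promises (`PromiseBQPWith_eq_PromiseBQP`); run the four families side by side on copies of the
input inside ONE polynomial-time generated circuit (`Juxt.circ`: the answer wires follow the product of
the four answer laws, `Juxt.probEvent_circ`; generator `Juxt.codeFP_gen`; executor and classical
post-processing `isQSolvable_of_generated_circuits`, decision `mem_BQP_of_isQSolvable_bit`, packaged as
`Juxt.mem_BQP_of_truthTable`) with the truth table "answer by table on `E`, else `g ∧ (q₁ ∨ q₂ ∨ q₃)`";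
the error budget only ever uses the promised sides: member `⇒` the cylinder `{g = 1, qᵢ = 1}` has mass
`≥ (23/24)²`, non-member `⇒` `{g = 0}` has mass `≥ 23/24` or `{q₁ = q₂ = q₃ = 0}` has mass `≥ (23/24)³`,
all `≥ 2/3` (`Juxt.prod_le_sum_of_cylinder`). [cite: Watrous2009, §III.2 and §IV.4]
[cite: BernsteinVazirani1997, §8] [cite: BennettBernsteinBrassardVazirani1997, Thm. 4.13 and Cor. 4.15] -/
theorem stub_guardedOr :
    ∀ (L G : Language Bool) (Q₁ Q₂ Q₃ : PromiseProblem) (E : Finset (List Bool)),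
      G ∈ BQP → Q₁ ∈ PromiseBQP → Q₂ ∈ PromiseBQP → Q₃ ∈ PromiseBQP →
      (∀ w, w ∉ E → w ∈ L → w ∈ G ∧ (w ∈ Q₁.yes ∨ w ∈ Q₂.yes ∨ w ∈ Q₃.yes)) →
      (∀ w, w ∉ E → w ∉ L → w ∉ G ∨ (w ∈ Q₁.no ∧ w ∈ Q₂.no ∧ w ∈ Q₃.no)) →
        L ∈ BQP := by
  classical
  intro L G Q₁ Q₂ Q₃ E hG hQ₁ hQ₂ hQ₃ hyes hno
  -- the four promise problems and their amplified families
  set Qs : Fin 4 → PromiseProblem := ![PromiseProblem.ofLanguage G, Q₁, Q₂, Q₃] with hQs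
  have hQmem : ∀ j, Qs j ∈ PromiseBQP := by
    intro j
    fin_cases j
    · exact ofLanguage_mem_PromiseBQP_iff.2 hG
    · exact hQ₁
    · exact hQ₂
    · exact hQ₃
  choose fam hfree hU hQyes hQno using fun j => guardedOr_exists_family (hQmem j)
  -- the truth table: hard-wired on `E`, the guarded OR elsewhere
  set Es : List (List Bool) := E.toList with hEs
  set Ts : List (List Bool) := (E.filter fun w => w ∈ L).toList with hTs
  set Φ : List Bool → (Fin 4 → Bool) → Bool := fun x γ =>
    if decide (x ∈ Es) then decide (x ∈ Ts) else (γ 0 && (γ 1 || γ 2 || γ 3)) with hΦ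
  refine Juxt.mem_BQP_of_truthTable fam hfree hU Φ L.boolIndicator (fun x => (Set.mem_iff_boolIndicator L x).symm)
    (guardedOr_codeFP_table fam hU Es Ts) fun x => ?_
  -- the error budget
  set w : Fin 4 → Bool → ℝ := fun j c => Juxt.answerWeight (fam j) x c with hw
  have hw0 : ∀ j c, 0 ≤ w j c := fun j c => Juxt.answerWeight_nonneg (fam j) x c
  have hw1 : ∀ j, w j true + w j false = 1 := fun j => Juxt.answerWeight_true_add_false (fam j) x
  have hwyes : ∀ j, x ∈ (Qs j).yes → 23 / 24 ≤ w j true := fun j hj => by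
    have := hQyes j x hj
    simp only [hw, Juxt.answerWeight, if_true]
    linarith
  have hwno : ∀ j, x ∈ (Qs j).no → 23 / 24 ≤ w j false := fun j hj => by
    have := hQno j x hj
    simp only [hw, Juxt.answerWeight, Bool.false_eq_true, if_false]
    linarith
  show 2 / 3 ≤ ∑ γ : Fin 4 → Bool, if Φ x γ = L.boolIndicator x then ∏ j, w j (γ j) else 0
  by_cases hxE : x ∈ E
  · -- hard-wired answer
    refine guardedOr_cylinder w hw0 hw1 ∅ (fun _ => true) _ _ (fun γ _ => ?_) (by norm_num)
    have hT : decide (x ∈ Ts) = L.boolIndicator x := by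
      by_cases hxL : x ∈ L
      · rw [(Set.mem_iff_boolIndicator L x).1 hxL, decide_eq_true]
        rw [hTs, Finset.mem_toList, Finset.mem_filter]; exact ⟨hxE, hxL⟩
      · rw [(Set.notMem_iff_boolIndicator L x).1 hxL, decide_eq_false]
        rw [hTs, Finset.mem_toList, Finset.mem_filter]; exact fun h => hxL h.2
    rw [hΦ]
    dsimp only
    rw [if_pos (decide_eq_true (Finset.mem_toList.2 hxE)), hT]
  · have hoff : ∀ γ, Φ x γ = (γ 0 && (γ 1 || γ 2 || γ 3)) := fun γ => by
      rw [hΦ]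
      dsimp only
      rw [if_neg]
      rw [hEs, decide_eq_true_eq, Finset.mem_toList]
      exact hxE
    simp_rw [hoff]
    by_cases hxL : x ∈ L
    · rw [(Set.mem_iff_boolIndicator L x).1 hxL]
      obtain ⟨hxG, hxQ⟩ := hyes x hxE hxL
      have h0 : 23 / 24 ≤ w 0 true := hwyes 0 (by simpa [hQs] using hxG)
      have key : ∀ i : Fin 4, i ≠ 0 → (i = 1 ∨ i = 2 ∨ i = 3) → 23 / 24 ≤ w i true →
          2 / 3 ≤ ∑ γ : Fin 4 → Bool, if (γ 0 && (γ 1 || γ 2 || γ 3)) = true then ∏ j, w j (γ j) else 0 := by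
        intro i hi0 hi hwi
        refine guardedOr_cylinder w hw0 hw1 {0, i} (fun _ => true) _ _ (fun γ hγ => ?_) ?_
        · have hγ0 : γ 0 = true := hγ 0 (by simp)
          have hγi : γ i = true := hγ i (by simp)
          rcases hi with rfl | rfl | rfl <;> simp [hγ0, hγi]
        · rw [Finset.prod_pair hi0.symm]
          nlinarith [hw0 0 true, hw0 i true]
      rcases hxQ with h | h | h
      · exact key 1 (by decide) (Or.inl rfl) (hwyes 1 (by simpa [hQs] using h))
      · exact key 2 (by decide) (Or.inr (Or.inl rfl)) (hwyes 2 (by simpa [hQs] using h))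
      · exact key 3 (by decide) (Or.inr (Or.inr rfl)) (hwyes 3 (by simpa [hQs] using h))
    · rw [(Set.notMem_iff_boolIndicator L x).1 hxL]
      rcases hno x hxE hxL with hxG | ⟨h1, h2, h3⟩
      · have h0 : 23 / 24 ≤ w 0 false := hwno 0 (show x ∈ Gᶜ from hxG)
        refine guardedOr_cylinder w hw0 hw1 {0} (fun _ => false) _ _ (fun γ hγ => ?_) ?_
        · simp [hγ 0 (by simp)]
        · rw [Finset.prod_singleton]; linarith
      · have h1' : 23 / 24 ≤ w 1 false := hwno 1 (by simpa [hQs] using h1)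
        have h2' : 23 / 24 ≤ w 2 false := hwno 2 (by simpa [hQs] using h2)
        have h3' : 23 / 24 ≤ w 3 false := hwno 3 (by simpa [hQs] using h3)
        refine guardedOr_cylinder w hw0 hw1 {1, 2, 3} (fun _ => false) _ _ (fun γ hγ => ?_) ?_
        · simp [hγ 1 (by simp), hγ 2 (by simp), hγ 3 (by simp)]
        · rw [Finset.prod_insert (by decide), Finset.prod_pair (by decide)]
          have h23 : (23 / 24) * (23 / 24) ≤ w 2 false * w 3 false :=
            mul_le_mul h2' h3' (by norm_num) (hw0 2 false)
          nlinarith [hw0 1 false, mul_nonneg (hw0 2 false) (hw0 3 false)]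

end Summit.QuantumAdvantage.QuantumAdvantage.Theorems.ArithStatLadder.IqThreeMemBQP
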